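import Summits.ValiantsHypothesis.ValiantsHypothesis.Theorems.BarrierLeverAnchoredDoorHitsLowerPairsEvalDoor
import Summits.ValiantsHypothesis.ValiantsHypothesis.Theorems.BarrierLeverAnchoredDoorHitsLowerPairsSupportGeneric
import Summits.ValiantsHypothesis.ValiantsHypothesis.Theorems.BarrierLeverAnchoredDoorHitsLowerPairsThinSide

/-!
# Support item `AnchoredDoorHitsLowerPairs` (stmt-ValiantsHypothesis-22510), line `anchored-peeling`:
# THE THREE-MATRIX DOOR («U-door») and its TOTAL NONSINGULARITY conjecture

Helper file (`--supports stmt-ValiantsHypothesis-22510`; cell valiant-natproofs, rung V4, 𝒟-side door (c); registered line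
`Cruxes/AnchoredDoorHitsLowerPairs/Lines/anchored_peeling.lean` v30 (registered stubs `stub_conjBiEval`, `stub_ltRestNonCanonRSWPD`,
`stub_vertexStep`, `stub_lefStep`, `stub_crossed`, `stub_sr`, `stub_conjM`); prover seat val-np-p1 gen 29; memo
HOME/val-np-p1/g29/MEMO-udoor-valnp1-g29.md). Closes NO item.

WHAT. A member of the profile-1 anchored door 𝔄₁ given by THREE complex matrices `θ : X × Y`, `Φ : Y × X`, `Ψ : X × Y` (here
`X = Y = Fin h`): the vertex anchor `(a | d)` gets weight `θ a d`, the `x`-tail `Φ d b` at EVERY other row vertex `b` (the tail depends on the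
anchor's COLUMN vertex only) and the `y`-tail `Ψ a e` at every other column vertex `e` (depends on the anchor's ROW vertex only):
`uDoorPoint θ Φ Ψ`. In the zeon algebra this member is `exp(Σ_{a,d} θ_{ad} X_a Y_d)` with `X_a = x_a e^{Ψ_a·y}`, `Y_d = y_d e^{Φ_d·x}`, so its
layout has the CLOSED FORM `M(U,W) = Σ_{A ⊆ U, D ⊆ W, |A| = |D|} perm θ[A,D] · Φ_D^{U∖A} · Ψ_A^{W∖D}` (`Φ_D = Σ_{d∈D} Φ_d`, `Ψ_A = Σ_{a∈A} Ψ_a`;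
sum over spanning «double-star forests» of `K_{U,W}`), i.e. `M = P̃ · diag(perm θ[A,D]) · Q̃ᵀ` with the Hermite subset-sum matrices
`P̃[U,(A,D)] = (∂^A z^U)(Φ_D)`, `Q̃[W,(A,D)] = (∂^D w^W)(Ψ_A)`, and the symmetric pairing
`B(p,q) = Σ_{|A|=|D|} perm θ[A,D] (∂^A p)(Φ_D) (∂^D q)(Ψ_A)` on `Π_R × Π_C` (memo §2). NUMERICS (memo §3; exact mod 2³¹−1): nonsingular on ALL
2 112 lower pairs with ≤ 5+5 vertices, on all 29 named pairs of the line up to `r = 1023` in both orientations (kit j330779), and — beyond lower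
pairs — on every sampled square submatrix of the layout on NONEMPTY faces (ALL minors for `h = 3`, all `k ≤ 3` minors for `h = 4`, > 6·10⁴ random
minors for `h ≤ 6` and rectangular shapes; kit j330779 extends the census): the U-door layout appears to be TOTALLY NONSINGULAR.
* `uDoorPoint θ Φ Ψ` — the parameter point.   * `Stmt.conjUDoor` — U1 by the U-door (offered node text).
* `Stmt.conjUDoorTNS` — total nonsingularity of the U-door layout (matched emptiness), offered; `conjUDoor_of_conjUDoorTNS`,
  `stub_totallyNonsingular_of_conjUDoorTNS` (⟹ TU1 of the skeleton, `Stmt.stub_totallyNonsingular`).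
* arrows BY NAME: `symbolicDet_ne_zero_of_conjUDoor` (every profile `s ≥ 1`), `stub_vertexStep_of_conjUDoor` (the registered stub),
  `stub_ltRestNonCanonRSW_of_conjUDoor`, `anchoredDoorHitsLowerPairs_of_conjUDoor` (the route decl), and the `…_of_conjUDoorTNS` versions.
WHY IT MIGHT FAIL: a lower pair (resp. a square submatrix on nonempty faces) on which the three-matrix member is identically singular; the
cheaper relatives ARE singular somewhere — the two-vector «proportional-tail» member `Φ_d = c_d·F`, `Ψ_a = c'_a·S` dies on deep-versus-wide pairs by a
dimension count (punct₆ vs tB(10,2): rank 46/48), the diagonal member `θ = 1` dies on (P₃, K₃ ⊔ pt), the one-sided members `Φ = 0` / `Ψ = 0`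
die off the nested-Hall class (memo §4).

WHAT THIS IS NOT: the conjectures are NOT proved here; no pair is certified here; nothing on crux stmt-ValiantsHypothesis-14610 or on
`VP` versus `VNP`.
-/

set_option linter.dupNamespace false

namespace Summit.ValiantsHypothesis.ValiantsHypothesis.Theorems.BarrierLever.AnchoredPeeling

open Finset MvPolynomial

noncomputable section

variable {h : ℕ}

/-- **The U-door point of 𝔄₁ for three matrices `θ Φ Ψ : Fin h → Fin h → ℂ`:** the vertex anchor `(a | d)` has weight `θ a d`,
`x`-tail `Φ d b` at the row vertex `b` (a function of the anchor's column vertex `d` only) and `y`-tail `Ψ a e` at the column vertex `e`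
(a function of the anchor's row vertex `a` only). Values on non-singleton anchors: the corresponding sums (irrelevant at profile 1). -/
def uDoorPoint (θ Φ Ψ : Fin h → Fin h → ℂ) : Param h → ℂ
  | Sum.inl β => ∑ a ∈ β.1, ∑ d ∈ β.2, θ a d
  | Sum.inr (Sum.inl (β, b)) => ∑ d ∈ β.2, Φ d b
  | Sum.inr (Sum.inr (β, e)) => ∑ a ∈ β.1, Ψ a e

/-- **CONJECTURE U (the three-matrix door hits every lower pair; offered node text).** For all `h`, `r` and every pair of injective
enumerations `u`, `w` of lower families, SOME three matrices `θ Φ Ψ` make the profile-1 symbolic minor nonzero at `uDoorPoint θ Φ Ψ`.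
Equivalently (closed form): `det [Σ_{A ⊆ u i, D ⊆ w j, |A| = |D|} perm θ[A,D] Φ_D^{u i ∖ A} Ψ_A^{w j ∖ D}]_{i j} ≠ 0` for some `θ Φ Ψ`. -/
def Stmt.conjUDoor : Prop :=
  ∀ (h r : ℕ) (u w : Fin r → Finset (Fin h)), Function.Injective u → Function.Injective w →
    IsLowerSet (Set.range u) → IsLowerSet (Set.range w) →
    ∃ θ Φ Ψ : Fin h → Fin h → ℂ, MvPolynomial.eval (uDoorPoint θ Φ Ψ) (symbolicDet 1 h r u w) ≠ 0

/-- **CONJECTURE TNS (total nonsingularity of the three-matrix door; offered node text).** For all `h`, `r` and every pair of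
injective enumerations `u`, `w` of ARBITRARY face families with matched emptiness (`∅` is a row iff `∅` is a column), some `θ Φ Ψ` make the
profile-1 symbolic minor nonzero at `uDoorPoint θ Φ Ψ` — i.e. the U-door layout on nonempty faces is totally nonsingular for generic
`θ Φ Ψ`. Implies Conjecture U and the skeleton's TU1 (`Stmt.stub_totallyNonsingular`). -/
def Stmt.conjUDoorTNS : Prop :=
  ∀ (h r : ℕ) (u w : Fin r → Finset (Fin h)), Function.Injective u → Function.Injective w →
    ((∃ i, u i = ∅) ↔ (∃ j, w j = ∅)) →
    ∃ θ Φ Ψ : Fin h → Fin h → ℂ, MvPolynomial.eval (uDoorPoint θ Φ Ψ) (symbolicDet 1 h r u w) ≠ 0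

/-- **TNS ⟹ U.** -/
theorem conjUDoor_of_conjUDoorTNS (hT : Stmt.conjUDoorTNS) : Stmt.conjUDoor :=
  fun h r u w hu hw hlu hlw => hT h r u w hu hw (ProductRule.empty_iff_of_lowerSets u w hlu hlw)

/-- **TNS ⟹ TU1** (`Stmt.stub_totallyNonsingular`: a numeric point where the symbolic minor does not vanish). -/
theorem stub_totallyNonsingular_of_conjUDoorTNS (hT : Stmt.conjUDoorTNS) : Stmt.stub_totallyNonsingular := by
  intro h r u w hu hw hm h0
  obtain ⟨θ, Φ, Ψ, hne⟩ := hT h r u w hu hw hm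
  exact hne (by rw [h0, map_zero])

/-- **U ⟹ U1 at every profile `s ≥ 1`:** every injective lower pair has nonzero symbolic minor. -/
theorem symbolicDet_ne_zero_of_conjUDoor (hU : Stmt.conjUDoor) {s h r : ℕ} (hs : 1 ≤ s) (u w : Fin r → Finset (Fin h))
    (hu : Function.Injective u) (hw : Function.Injective w) (hlu : IsLowerSet (Set.range u)) (hlw : IsLowerSet (Set.range w)) :
    symbolicDet s h r u w ≠ 0 := by
  obtain ⟨θ, Φ, Ψ, hne⟩ := hU h r u w hu hw hlu hlw
  refine symbolicDet_ne_zero_mono hs (fun h0 => hne ?_)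
  rw [h0, map_zero]

/-- **U ⟹ THE REGISTERED STUB `stub_vertexStep`** (outright). -/
theorem stub_vertexStep_of_conjUDoor (hU : Stmt.conjUDoor) : Stmt.stub_vertexStep := by
  intro h r u w hu hw hlu hlw _ _ _
  exact symbolicDet_ne_zero_of_conjUDoor hU (le_refl 1) u w hu hw hlu hlw

/-- **U ⟹ the residual `Stmt.stub_ltRestNonCanonRSW` OUTRIGHT** (at `s = 1`, `h₀ = 0`). -/
theorem stub_ltRestNonCanonRSW_of_conjUDoor (hU : Stmt.conjUDoor) : Stmt.stub_ltRestNonCanonRSW := by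
  refine ⟨1, 0, le_refl 1, ?_⟩
  intro h _ r u w hu hw hlu hlw _ _ _ _ _ _ _ _ _ _ _ _ _
  exact symbolicDet_ne_zero_of_conjUDoor hU (le_refl 1) u w hu hw hlu hlw

/-- **Composition BY NAME: `Stmt.conjUDoor → AnchoredDoorHitsLowerPairs`.** -/
theorem anchoredDoorHitsLowerPairs_of_conjUDoor (hU : Stmt.conjUDoor) :
    Summit.ValiantsHypothesis.ValiantsHypothesis.Theses.BarrierLever.AnchoredDoorHitsLowerPairs :=
  anchoredDoorHitsLowerPairs_of_ltRestNonCanonRSW (stub_ltRestNonCanonRSW_of_conjUDoor hU)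

/-- **TNS ⟹ the registered stub `stub_vertexStep`.** -/
theorem stub_vertexStep_of_conjUDoorTNS (hT : Stmt.conjUDoorTNS) : Stmt.stub_vertexStep :=
  stub_vertexStep_of_conjUDoor (conjUDoor_of_conjUDoorTNS hT)

/-- **Composition BY NAME: `Stmt.conjUDoorTNS → AnchoredDoorHitsLowerPairs`.** -/
theorem anchoredDoorHitsLowerPairs_of_conjUDoorTNS (hT : Stmt.conjUDoorTNS) :
    Summit.ValiantsHypothesis.ValiantsHypothesis.Theses.BarrierLever.AnchoredDoorHitsLowerPairs :=
  anchoredDoorHitsLowerPairs_of_conjUDoor (conjUDoor_of_conjUDoorTNS hT)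

end

end Summit.ValiantsHypothesis.ValiantsHypothesis.Theorems.BarrierLever.AnchoredPeeling
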